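import Literature.NumberTheory.Automorphic.ArithmeticQuotientCohomology
import HarnessLib

/-!
# Hecke operators on `H⁰` of an arithmetic quotient are the double-coset operators on
# invariant functions

Topic `NumberTheory/Automorphic`; namespace `Literature.NumberTheory.Automorphic.ArithmeticQuotient`;
theorems only.  Generic degree-`0` bookkeeping for the tree's model
`H^i(X_L, M) = H^i(Γ, Fun(𝒢 ⧸ L, M))` (`ArithmeticQuotientCohomology`): Mathlib's
`groupCohomology.H0Iso : H⁰(Γ, A) ≅ A^Γ` transports the Hecke operator `T_g = [L g L]` on
`H⁰(X_L, M)` (`heckeEnd … 0`, functoriality of group cohomology) to the double-coset operator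
`heckeFun` on the `Γ`-INVARIANT functions `Fun(Γ \ 𝒢 ⧸ L, M)` (naturality
`groupCohomology.map_id_comp_H0Iso_hom`).  Proof file supporting the named fact
`Literature.NumberTheory.Automorphic.hidaControl_dominantOrdinaryPoint` (the degree-`0` part of the
tree's all-degree ordinary Hecke algebra `𝕋^{S,ord}(𝒰)`: with
`GL2AdelicInvariantFunctionsDet`, `U_{v,1}` is nilpotent on `H⁰(X_{U(r)}, ℤ/p^s)`).

* `coe_H0Iso_hom_heckeEnd` — `H0Iso (T_g x) = T_g (H0Iso x)` as functions `𝒢 ⧸ L → M`.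
* `coe_H0Iso_hom_heckeEnd_pow` — the same for powers `T_g^m`.
* `heckeEnd_zero_pow_eq_zero` — **if `[L g L]^m` kills every `Γ`-invariant function, then
  `T_g^m = 0` on `H⁰(X_L, M)`.**

## References

* G. Shimura, *Introduction to the arithmetic theory of automorphic functions* (1971), Ch. 3,
  §3.1 (double-coset operators) [ShimuraIATAF1971].
* P. Scholze, *On torsion in the cohomology of locally symmetric varieties*, Ann. of Math. 182
  (2015), §V.4 [Scholze2015].
-/

noncomputable section

open CategoryTheory groupCohomology

universe u

namespace Literature.NumberTheory.Automorphic.ArithmeticQuotient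

variable (k : Type u) [CommRing k] {Γ 𝒢 : Type u} [Group Γ] [Group 𝒢] (ι : Γ →* 𝒢)
  (L : Subgroup 𝒢) (g : 𝒢) (M : Type u) [AddCommGroup M] [Module k M]

/-- **In degree `0` the Hecke operator is the double-coset operator on invariant functions**:
under `H0Iso : H⁰(X_L, M) ≅ Fun(𝒢 ⧸ L, M)^Γ`, `T_g x ↦ [L g L] (x)` (naturality of `H0Iso`,
`groupCohomology.map_id_comp_H0Iso_hom`). [cite: ShimuraIATAF1971, Ch. 3, §3.1] -/
theorem coe_H0Iso_hom_heckeEnd (x : cohomology k ι L M 0) :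
    (((H0Iso (coeffRep k ι L M)).hom (heckeEnd k L g M ι 0 x) :
        (coeffRep k ι L M).ρ.invariants) : (𝒢 ⧸ L) → M) =
      heckeFun k L g M
        ((((H0Iso (coeffRep k ι L M)).hom x : (coeffRep k ι L M).ρ.invariants)) :
          (𝒢 ⧸ L) → M) := by
  have h := groupCohomology.map_id_comp_H0Iso_hom_apply (heckeRepHom k L g M ι) x
  change (((H0Iso (coeffRep k ι L M)).hom ((heckeOperator k L g M ι 0) x) :
    (coeffRep k ι L M).ρ.invariants) : (𝒢 ⧸ L) → M) = _
  rw [h]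
  rfl

/-- Powers: `H0Iso (T_g^m x) = [L g L]^m (H0Iso x)`. [folklore] -/
theorem coe_H0Iso_hom_heckeEnd_pow (m : ℕ) (x : cohomology k ι L M 0) :
    (((H0Iso (coeffRep k ι L M)).hom ((heckeEnd k L g M ι 0 ^ m) x) :
        (coeffRep k ι L M).ρ.invariants) : (𝒢 ⧸ L) → M) =
      (heckeFun k L g M ^ m)
        ((((H0Iso (coeffRep k ι L M)).hom x : (coeffRep k ι L M).ρ.invariants)) :
          (𝒢 ⧸ L) → M) := by
  induction m generalizing x with
  | zero => rfl
  | succ m ih =>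
    rw [pow_succ, Module.End.mul_apply, ih, coe_H0Iso_hom_heckeEnd, ← Module.End.mul_apply,
      ← pow_succ]

/-- **If `[L g L]^m` kills every `Γ`-invariant function, then `T_g^m = 0` on `H⁰(X_L, M)`.**
[folklore] -/
theorem heckeEnd_zero_pow_eq_zero {m : ℕ}
    (h : ∀ f : (𝒢 ⧸ L) → M, (∀ γ : Γ, coeffRepresentation k ι L M γ f = f) →
      (heckeFun k L g M ^ m) f = 0) :
    heckeEnd k L g M ι 0 ^ m = 0 := by
  refine LinearMap.ext fun x => ?_
  have hinj : Function.Injective ((H0Iso (coeffRep k ι L M)).hom : cohomology k ι L M 0 → _) :=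
    (H0Iso (coeffRep k ι L M)).toLinearEquiv.injective
  apply hinj
  rw [LinearMap.zero_apply, map_zero]
  apply Subtype.ext
  rw [coe_H0Iso_hom_heckeEnd_pow, ZeroMemClass.coe_zero]
  exact h _ fun γ => ((H0Iso (coeffRep k ι L M)).hom x).2 γ

end Literature.NumberTheory.Automorphic.ArithmeticQuotient
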